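import Literature.NumberTheory.Automorphic.GaussCellGL
import HarnessLib

/-!
# Existence of the Gauss decomposition `g = ℓ t r` when the leading minors are units

Topic `NumberTheory/Automorphic`; namespace `Literature.NumberTheory.Automorphic`. Complement to
`GaussCellGL` (which proves uniqueness and regularity of the Gauss factors): over a **commutative ring**
`R`, a square matrix `g` over `Fin m` all of whose leading principal minors `Δ_a(g)` (`leadMinor id g a`,
`a : Fin m`) are units and whose determinant is a unit factors as

  `g = ℓ · t · r`, `ℓ` lower unitriangular, `t = diag(d)` with `d` units, `r` upper unitriangular

(`exists_gauss_decomposition_of_isUnit_leadMinor`): with `S = gaussS id g` (`g S` lower triangular,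
`S` upper triangular with diagonal `Δ_j`), `S₁ = S · diag(Δ⁻¹)` is upper unitriangular, `g S₁` is lower
triangular with unit diagonal (its determinant is `det g`), and `g = (g S₁ D⁻¹) · D · S₁⁻¹`,
`D = diag(g S₁)`. This is the big cell `N⁻ T N` of `GL_m` cut out by the non-vanishing of the leading
minors (Springer 8.3.11, Borel 14.12). Also: the leading blocks and minors of a product `x b` with `b`
upper triangular (`leadBlock_mul_of_blockTriangular`, `leadMinor_mul_of_blockTriangular`), and the
leading minors of an upper triangular matrix (`leadMinor_of_blockTriangular`).

Everything is proved; no named fact is introduced.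

## References

* T. A. Springer, *Linear Algebraic Groups*, 2nd ed. (1998), 8.3.11 and Exercise 8.3.12 (2). [SpringerLAG1998]
* A. Borel, *Linear Algebraic Groups*, 2nd ed. (1991), IV.14.12. [Borel1991]
-/

open scoped MatrixGroups
open Matrix OrderDual

noncomputable section

namespace Literature.NumberTheory.Automorphic

variable {R : Type*} [CommRing R] {m : ℕ}

/-! ### 1. Leading blocks of products with triangular matrices -/

/-- **Leading blocks against an upper triangular right factor**: `(x b)|_{<a} = x|_{<a} b|_{<a}`. [folklore] -/
theorem leadBlock_mul_of_blockTriangular (x : Matrix (Fin m) (Fin m) R) {b : Matrix (Fin m) (Fin m) R}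
    (hb : b.BlockTriangular (_root_.id : Fin m → Fin m)) (a : Fin m) :
    leadBlock (_root_.id : Fin m → Fin m) (x * b) a = leadBlock _root_.id x a * leadBlock _root_.id b a := by
  ext i j
  simp only [leadBlock, toBlock_apply, Matrix.mul_apply]
  rw [← Fintype.sum_subtype_add_sum_subtype (fun l : Fin m => _root_.id l < a) (fun l => x i l * b l j)]
  conv_rhs => rw [← add_zero (∑ l : {l : Fin m // _root_.id l < a}, x i l * b l j)]
  congr 1
  refine Finset.sum_eq_zero fun l _ => ?_
  have hl : a ≤ l := not_lt.1 l.2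
  have hjl : (j : Fin m) < l := lt_of_lt_of_le j.2 hl
  rw [hb hjl, mul_zero]

/-- **Leading blocks against a lower triangular left factor**: `(b x)|_{<a} = b|_{<a} x|_{<a}`. [folklore] -/
theorem leadBlock_mul_of_blockTriangular_dual {b : Matrix (Fin m) (Fin m) R}
    (hb : b.BlockTriangular (⇑toDual ∘ (_root_.id : Fin m → Fin m))) (x : Matrix (Fin m) (Fin m) R) (a : Fin m) :
    leadBlock (_root_.id : Fin m → Fin m) (b * x) a = leadBlock _root_.id b a * leadBlock _root_.id x a := by
  ext i j
  simp only [leadBlock, toBlock_apply, Matrix.mul_apply]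
  rw [← Fintype.sum_subtype_add_sum_subtype (fun l : Fin m => _root_.id l < a) (fun l => b i l * x l j)]
  conv_rhs => rw [← add_zero (∑ l : {l : Fin m // _root_.id l < a}, b i l * x l j)]
  congr 1
  refine Finset.sum_eq_zero fun l _ => ?_
  have hl : a ≤ l := not_lt.1 l.2
  have hil : (i : Fin m) < l := lt_of_lt_of_le i.2 hl
  rw [hb (toDual_lt_toDual.2 hil), zero_mul]

/-- Leading minors against an upper triangular right factor are multiplicative. [folklore] -/
theorem leadMinor_mul_of_blockTriangular (x : Matrix (Fin m) (Fin m) R) {b : Matrix (Fin m) (Fin m) R}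
    (hb : b.BlockTriangular (_root_.id : Fin m → Fin m)) (a : Fin m) :
    leadMinor (_root_.id : Fin m → Fin m) (x * b) a = leadMinor _root_.id x a * leadMinor _root_.id b a := by
  rw [leadMinor, leadBlock_mul_of_blockTriangular x hb, det_mul, leadMinor, leadMinor]

/-- Leading minors against a lower triangular left factor are multiplicative. [folklore] -/
theorem leadMinor_mul_of_blockTriangular_dual {b : Matrix (Fin m) (Fin m) R}
    (hb : b.BlockTriangular (⇑toDual ∘ (_root_.id : Fin m → Fin m))) (x : Matrix (Fin m) (Fin m) R) (a : Fin m) :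
    leadMinor (_root_.id : Fin m → Fin m) (b * x) a = leadMinor _root_.id b a * leadMinor _root_.id x a := by
  rw [leadMinor, leadBlock_mul_of_blockTriangular_dual hb x, det_mul, leadMinor, leadMinor]

/-- **Leading minors of an upper triangular matrix**: `Δ_a(b) = ∏_{i < a} b_{ii}`. [folklore] -/
theorem leadMinor_of_blockTriangular {b : Matrix (Fin m) (Fin m) R} (hb : b.BlockTriangular (_root_.id : Fin m → Fin m))
    (a : Fin m) : leadMinor (_root_.id : Fin m → Fin m) b a = ∏ i : {i : Fin m // i < a}, b i i := by
  rw [leadMinor, leadBlock]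
  have h : (b.toBlock (fun i => _root_.id i < a) (fun i => _root_.id i < a)).BlockTriangular _root_.id :=
    fun i j hij => hb hij
  rw [Matrix.det_of_upperTriangular h]
  rfl

/-- Leading minors of a lower triangular matrix: `Δ_a(b) = ∏_{i < a} b_{ii}`. [folklore] -/
theorem leadMinor_of_blockTriangular_dual {b : Matrix (Fin m) (Fin m) R}
    (hb : b.BlockTriangular (⇑toDual ∘ (_root_.id : Fin m → Fin m))) (a : Fin m) :
    leadMinor (_root_.id : Fin m → Fin m) b a = ∏ i : {i : Fin m // i < a}, b i i := by
  rw [leadMinor, leadBlock]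
  have h : (b.toBlock (fun i => _root_.id i < a) (fun i => _root_.id i < a)).BlockTriangular ⇑toDual :=
    fun i j hij => hb hij
  rw [Matrix.det_of_lowerTriangular _ h]
  rfl

/-- The leading minors of an upper unitriangular matrix are `1`. [folklore] -/
theorem IsBlockUpperUnipotent.leadMinor_eq_one {r : Matrix (Fin m) (Fin m) R}
    (hr : IsBlockUpperUnipotent (_root_.id : Fin m → Fin m) r) (a : Fin m) : leadMinor (_root_.id : Fin m → Fin m) r a = 1 := by
  rw [leadMinor_of_blockTriangular hr.1]
  exact Finset.prod_eq_one fun i _ => by rw [hr.2 i i rfl, Matrix.one_apply_eq]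

/-- The leading minors of a lower unitriangular matrix are `1`. [folklore] -/
theorem IsBlockLowerUnipotent.leadMinor_eq_one {ℓ : Matrix (Fin m) (Fin m) R}
    (hℓ : IsBlockLowerUnipotent (_root_.id : Fin m → Fin m) ℓ) (a : Fin m) : leadMinor (_root_.id : Fin m → Fin m) ℓ a = 1 := by
  rw [leadMinor_of_blockTriangular_dual hℓ.1]
  exact Finset.prod_eq_one fun i _ => by rw [hℓ.2 i i rfl, Matrix.one_apply_eq]

/-! ### 2. Existence of the decomposition -/

/-- A diagonal entry of a lower triangular matrix divides its determinant. [folklore] -/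
theorem isUnit_diag_of_isUnit_det_of_blockTriangular_dual {L : Matrix (Fin m) (Fin m) R}
    (hL : L.BlockTriangular (⇑toDual ∘ (_root_.id : Fin m → Fin m))) (hdet : IsUnit L.det) (i : Fin m) : IsUnit (L i i) := by
  have h : L.det = ∏ j, L j j := Matrix.det_of_lowerTriangular L (fun a b hab => hL hab)
  rw [h] at hdet
  exact isUnit_of_dvd_unit (Finset.dvd_prod_of_mem (fun j => L j j) (Finset.mem_univ i)) hdet

/-- Over a commutative ring: the diagonal entry `(S⁻¹)_{jj}` of the inverse of an upper triangular matrix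
with unit determinant is the inverse of `S_{jj}`. [folklore] -/
theorem inv_apply_diag_mul_of_blockTriangular {S : Matrix (Fin m) (Fin m) R} (hS : S.BlockTriangular (_root_.id : Fin m → Fin m))
    (hdet : IsUnit S.det) (j : Fin m) : S⁻¹ j j * S j j = 1 := by
  haveI : Invertible S := Matrix.invertibleOfIsUnitDet S hdet
  have hinv : S⁻¹.BlockTriangular (_root_.id : Fin m → Fin m) := Matrix.blockTriangular_inv_of_blockTriangular hS
  have h := congr_fun (congr_fun (Matrix.nonsing_inv_mul S hdet) j) j
  rw [Matrix.mul_apply, Matrix.one_apply_eq] at h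
  rw [← h, Finset.sum_eq_single j]
  · intro l _ hl
    rcases lt_or_gt_of_ne hl with hlt | hgt
    · rw [hinv hlt, zero_mul]
    · rw [hS hgt, mul_zero]
  · exact fun h' => absurd (Finset.mem_univ j) h'

/-- **Existence of the Gauss decomposition from unit leading minors** (over a commutative ring): if all
leading principal minors `Δ_a(g)`, `a : Fin m`, and `det g` are units, then `g = ℓ diag(d) r` with `ℓ`
lower unitriangular, `d` units and `r` upper unitriangular.
[cite: SpringerLAG1998, 8.3.11 and Exercise 8.3.12 (2)] -/
theorem exists_gauss_decomposition_of_isUnit_leadMinor (g : Matrix (Fin m) (Fin m) R)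
    (hΔ : ∀ a : Fin m, IsUnit (leadMinor (_root_.id : Fin m → Fin m) g a)) (hg : IsUnit g.det) :
    ∃ (ℓ : Matrix (Fin m) (Fin m) R) (d : Fin m → Rˣ) (r : Matrix (Fin m) (Fin m) R),
      IsBlockLowerUnipotent (_root_.id : Fin m → Fin m) ℓ ∧ IsBlockUpperUnipotent (_root_.id : Fin m → Fin m) r ∧
        g = ℓ * Matrix.diagonal (fun i => (d i : R)) * r := by
  -- the normalised upper candidate `S₁ = S diag(Δ⁻¹)`
  set S : Matrix (Fin m) (Fin m) R := gaussS (_root_.id : Fin m → Fin m) g with hS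
  set S₁ : Matrix (Fin m) (Fin m) R := S * Matrix.diagonal fun j => Ring.inverse (leadMinor (_root_.id : Fin m → Fin m) g j)
    with hS₁
  have hS₁apply : ∀ i j, S₁ i j = S i j * Ring.inverse (leadMinor (_root_.id : Fin m → Fin m) g j) := fun i j => by
    rw [hS₁, Matrix.mul_diagonal]
  have hS₁u : IsBlockUpperUnipotent (_root_.id : Fin m → Fin m) S₁ := by
    refine ⟨fun i j hij => ?_, fun i j hij => ?_⟩
    · rw [hS₁apply, hS, gaussS_blockTriangular g hij, zero_mul]
    · rw [hS₁apply, hS, gaussS_apply_of_eq g hij, Matrix.one_apply]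
      have hij' : i = j := hij
      subst hij'
      rw [if_pos rfl, if_pos rfl]
      exact Ring.mul_inverse_cancel _ (hΔ i)
  -- `L₁ = g S₁` is lower triangular with unit diagonal entries
  set L₁ : Matrix (Fin m) (Fin m) R := g * S₁ with hL₁
  have hL₁low : L₁.BlockTriangular (⇑toDual ∘ (_root_.id : Fin m → Fin m)) := by
    intro i j hij
    rw [hL₁, hS₁, ← Matrix.mul_assoc, Matrix.mul_diagonal, hS, mul_gaussS_apply_of_lt g (toDual_lt_toDual.1 hij), zero_mul]
  have hS₁det : S₁.det = 1 := hS₁u.det_eq_one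
  have hL₁det : IsUnit L₁.det := by rw [hL₁, det_mul, hS₁det, mul_one]; exact hg
  have hdiag : ∀ i, IsUnit (L₁ i i) := isUnit_diag_of_isUnit_det_of_blockTriangular_dual hL₁low hL₁det
  set d : Fin m → Rˣ := fun i => (hdiag i).unit with hd
  have hdval : ∀ i, (d i : R) = L₁ i i := fun i => rfl
  -- the three factors
  set ℓ : Matrix (Fin m) (Fin m) R := L₁ * Matrix.diagonal fun i => (((d i)⁻¹ : Rˣ) : R) with hℓ
  set r : Matrix (Fin m) (Fin m) R := S₁⁻¹ with hr
  have hS₁detu : IsUnit S₁.det := by rw [hS₁det]; exact isUnit_one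
  refine ⟨ℓ, d, r, ⟨fun i j hij => ?_, fun i j hij => ?_⟩, hS₁u.inv, ?_⟩
  · rw [hℓ, Matrix.mul_diagonal, hL₁low hij, zero_mul]
  · have hij' : i = j := hij
    subst hij'
    rw [hℓ, Matrix.mul_diagonal, Matrix.one_apply_eq, ← hdval, Units.mul_inv]
  · -- `ℓ diag(d) r = L₁ S₁⁻¹ = g S₁ S₁⁻¹ = g`
    have h1 : ℓ * Matrix.diagonal (fun i => (d i : R)) = L₁ := by
      rw [hℓ, Matrix.mul_assoc, Matrix.diagonal_mul_diagonal]
      have : (fun i => (((d i)⁻¹ : Rˣ) : R) * (d i : R)) = fun _ => 1 := funext fun i => by rw [Units.inv_mul]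
      rw [this, Matrix.diagonal_one, Matrix.mul_one]
    rw [h1, hr, hL₁, Matrix.mul_assoc, Matrix.mul_nonsing_inv S₁ hS₁detu, Matrix.mul_one]

/-- **Leading minors of a Gauss product**: if `g = ℓ diag(d) r` then `Δ_a(g) = ∏_{i<a} d_i` — in particular
they are units. [folklore] -/
theorem leadMinor_gauss_product {ℓ r : Matrix (Fin m) (Fin m) R} (hℓ : IsBlockLowerUnipotent (_root_.id : Fin m → Fin m) ℓ)
    (hr : IsBlockUpperUnipotent (_root_.id : Fin m → Fin m) r) (d : Fin m → R) (a : Fin m) :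
    leadMinor (_root_.id : Fin m → Fin m) (ℓ * Matrix.diagonal d * r) a = ∏ i : {i : Fin m // i < a}, d i := by
  rw [leadMinor_mul_of_blockTriangular _ hr.1, hr.leadMinor_eq_one, mul_one, leadMinor_mul_of_blockTriangular_dual hℓ.1,
    hℓ.leadMinor_eq_one, one_mul, leadMinor_of_blockTriangular (Matrix.blockTriangular_diagonal d)]
  simp

end Literature.NumberTheory.Automorphic
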